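import Summits.BirchSwinnertonDyer.BirchSwinnertonDyer.Theorems.SignedLowerHalvesSprungLowerHalfAtThreeSelmerNineShape
import Summits.BirchSwinnertonDyer.Rank1Residual.Supersingular.RankZeroSurjThreeCertificates_01
import HarnessLib

/-!
# Route `SignedLowerHalves`, crux `SprungLowerHalfAtThree` (item stmt-BirchSwinnertonDyer-19003), its LEAF
# BRANCH `r_an = 0 ∧ surj(3)` PER PAIR — RECORDS part A of 4: `BSD(E,3)` for `2534f1`, `4229a1`, `4592f1`, `6118f1`, `6419b1`, `6970d1`, `7234b1`, `7310d1`, `7744n1`, `8272b1`, `8510c1`, `8747d1`, `9200w1`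
# from PUBLISHED facts + the landed two-engine `3`-descent rows (cell `bsd-ssimc`, seat `bsd-ssimc-k3-c5`
# gen 5; a `--supports … --as helper` file; closes nothing about the crux)

PARTITION (cell bsd-ssimc): X8 (A8) × 13 of the 49 window cells `r_an = 0 ∧ surj(3) ∧ ord₃ #Ш_an = 2`
(all 49 have `N < 2·10⁴`; 48 of them carried ONLY the K25-conditional offer `bsdp_x8r0kp3_*` before, and
`11123a1` — crux 5's BC5 «first value» pair — carried no `BSDp` theorem at all) — closes PER PAIR (OFFERS;
the desk books, nothing is booked here); types nothing new; crux 5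
(`Summit.BirchSwinnertonDyer.BirchSwinnertonDyer.Theses.SignedLowerHalves.SprungLowerHalfAtThree`) stays OPEN
(clause (A) = modularity, `…Characterization.lean`). HONEST FRAMING: BSD is not proved by any of this;
nothing here is new mathematics — the road is cell `b2b-bsdres`'s (consumer
`Supersingular.X8.bsdp_rankZero_of_casselsTate_of_selmerGroup_ne_bot_of_surj`, `DescentLowerBound.lean`;
rows `Supersingular/X8DescentRecords.lean`, x10b gen 5, kit j091546: engine 1 = x11b `desc3lib.gp` EXACT-3,
engine 2 = `desc3full_e2.py`, `dim_𝔽₃ Sel^(3)(E/ℚ) = 2` on both, same `𝔽₃`-subspace of `A^×/A^{×3}`);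
this seat only types the per-pair theorems that were never written off those rows. THEOREMS ONLY (no
definition, no named fact, no `sorry`).

Each record instantiates `X8.bsdp_three_rankZero_of_ainvs_of_selmerGroup_ne_bot_of_surj` (`…SelmerNineShape.lean`)
on the literal Cremona model: global minimality (bounded Kraus criterion), `3 ∤ Δ` and `#Ẽ(𝔽₃) ∈ {1, 7}`
are DECIDED by the kernel; `ρ̄_{E,3}` onto is the landed certificate `surj_x8r0_<label>_3`
(`RankZeroSurjThreeCertificates_0*`). What REMAINS displayed: the PUBLISHED named facts `hCT`
(Cassels–Tate), `hW` (Wuthrich 2014 Prop. 21), `hGZK`, `hmod`; per pair `hr` (`r_an = 0`, Cremona),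
`hq`/`hv` (`#Ш_an = q`, `ord₃ q ≤ 2`; here `#Ш_an = 9`), and the certificate line `hSel : Sel^(3)(E/ℚ) ≠ ⊥`
whose EVIDENCE is the landed row named in each docstring (`checked_x8_rankZero_sha9_desc3_k`, cert sha256
prefix) — the same tier as the tree's other flag-free per-pair A8 theorems (`bsdp3_b1n_*`, `bsdp3_nn*`).
Mathematics of the chain (all PROVED in the tree below the named facts): `r = 0` (GZK) and `E(ℚ)[3] = 0`
(`E[3]` irreducible on X8) make `Sel^(3)(E/ℚ) ↪ Ш[3]`, so `Ш[3] ≠ 0`, `3 ∣ #Ш`, `9 ∣ #Ш` (Cassels–Tate) =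
`ord₃ #Ш_an ≤ ord₃ #Ш`; Wuthrich's Prop. 21 (image onto) gives `≥`.

References: [Wuthrich2014] Prop. 21; [SilvermanAEC2009] Thm. X.4.14, VII.1 Rem. 1.1, VII.5 Prop. 5.1(a);
[Serre1972] §1.11 Prop. 12, §2.4 Prop. 15; [Miller2011LMS] Def. 1.1; [Cremona2006] Table 1; Schaefer–Stoll,
Trans. AMS 356 (2004) (the descent engines' method).
-/

set_option autoImplicit false
set_option linter.dupNamespace false

noncomputable section

open scoped Classical

open WeierstrassCurve Literature.NumberTheory.EllipticCurves
  Literature.NumberTheory.EllipticCurves.Rank1Residual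
  Literature.NumberTheory.EllipticCurves.Rank1Residual.Typed
  Literature.NumberTheory.EllipticCurves.Rank1Residual.X11RankOneCertificates
  Literature.NumberTheory.EllipticCurves.Wuthrich2014
  Summit.BirchSwinnertonDyer.BirchSwinnertonDyer.Rank1Residual.X11RankOne
  Summit.BirchSwinnertonDyer.Rank1Residual.Supersingular

namespace Summit.BirchSwinnertonDyer.BirchSwinnertonDyer.Theorems

/-- **`BSD(E,3)` for `2534f1`** — X8 ∩ {r_an = 0} ∩ {surj(3)}, `#Ш_an = 9`; Cremona model `[1,-1,1,-303,-1955]`,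
`N = 2534 = 2·7·181`, good supersingular at `3` with `a₃ = 3`, `ρ̄_{E,3}` onto (`surj_x8r0_2534f1_3`), `#E(ℚ)_tors = 1`,
`∏ c_ℓ = 1`. Kernel-decided: global minimality (the bounded Kraus certificate of `surj_x8r0_2534f1_3`, verbatim), `3 ∤ Δ`, `#Ẽ(𝔽₃) = 1`. Binders: PUBLISHED `hCT`,
`hW`, `hGZK`, `hmod`; per pair `hr`, `hq`/`hv` (`#Ш_an = 9`), `hSel : Sel^(3)(E/ℚ) ≠ ⊥` — EVIDENCE: the landed
two-engine exact `3`-descent row of `2534f1` in `Supersingular/X8DescentRecords.lean` (`checked_x8_rankZero_sha9_desc3_1`;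
`dim_𝔽₃ Sel^(3) = 2` on both engines, same subspace; cert `8c4dbcbd6259…`; kit j091546). Per pair; OFFER (the
desk books); class X8 and crux 5 unchanged. [cite: Wuthrich2014, Prop. 21 (p. 400)]
[cite: SilvermanAEC2009, Thm. X.4.14 and VII.1 Remark 1.1] [cite: Miller2011LMS, §1 and Def. 1.1]
[cite: Cremona2006, Table 1 (Cremona label 2534f1)] -/
theorem X8.bsdp3_sel9_2534f1 (hCT : exists_casselsTate_pairing (K := ℚ)) (hW : sha_dvd_analyticSha)
    (hGZK : rank_eq_analyticRank_of_analyticRank_le_one) (hmod : hasEntireLFunction_rat)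
    (W : WeierstrassCurve ℚ) (hWm : W = ⟨1, -1, 1, -303, -1955⟩) (hr : W.analyticRank = 0)
    {q : ℚ} (hq : shaAn W = (q : ℂ)) (hv : padicValRat 3 q ≤ 2) (hSel : W.selmerGroup (3 : ℤ) ≠ ⊥) :
    BSDp W 3 := by
  subst hWm
  exact X8.bsdp_three_rankZero_of_ainvs_of_selmerGroup_ne_bot_of_surj hCT hW hGZK hmod
    1 (-1) 1 (-303) (-1955)
    (isGloballyMinimal_of_krausCriterion_bounded 1 (-1) 1 (-303) (-1955)
      (by decide +kernel) (by decide +kernel) (by decide +kernel))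
    (by decide) (n₃ := 1) (by decide +kernel) (by decide) surj_x8r0_2534f1_3 hr hq hv hSel

/-- **`BSD(E,3)` for `4229a1`** — X8 ∩ {r_an = 0} ∩ {surj(3)}, `#Ш_an = 9`; Cremona model `[1,-1,1,-2091,-36272]`,
`N = 4229 = 4229`, good supersingular at `3` with `a₃ = 3`, `ρ̄_{E,3}` onto (`surj_x8r0_4229a1_3`), `#E(ℚ)_tors = 1`,
`∏ c_ℓ = 1`. Kernel-decided: global minimality (the bounded Kraus certificate of `surj_x8r0_4229a1_3`, verbatim), `3 ∤ Δ`, `#Ẽ(𝔽₃) = 1`. Binders: PUBLISHED `hCT`,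
`hW`, `hGZK`, `hmod`; per pair `hr`, `hq`/`hv` (`#Ш_an = 9`), `hSel : Sel^(3)(E/ℚ) ≠ ⊥` — EVIDENCE: the landed
two-engine exact `3`-descent row of `4229a1` in `Supersingular/X8DescentRecords.lean` (`checked_x8_rankZero_sha9_desc3_1`;
`dim_𝔽₃ Sel^(3) = 2` on both engines, same subspace; cert `55eb271ae15f…`; kit j091546). Per pair; OFFER (the
desk books); class X8 and crux 5 unchanged. [cite: Wuthrich2014, Prop. 21 (p. 400)]
[cite: SilvermanAEC2009, Thm. X.4.14 and VII.1 Remark 1.1] [cite: Miller2011LMS, §1 and Def. 1.1]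
[cite: Cremona2006, Table 1 (Cremona label 4229a1)] -/
theorem X8.bsdp3_sel9_4229a1 (hCT : exists_casselsTate_pairing (K := ℚ)) (hW : sha_dvd_analyticSha)
    (hGZK : rank_eq_analyticRank_of_analyticRank_le_one) (hmod : hasEntireLFunction_rat)
    (W : WeierstrassCurve ℚ) (hWm : W = ⟨1, -1, 1, -2091, -36272⟩) (hr : W.analyticRank = 0)
    {q : ℚ} (hq : shaAn W = (q : ℂ)) (hv : padicValRat 3 q ≤ 2) (hSel : W.selmerGroup (3 : ℤ) ≠ ⊥) :
    BSDp W 3 := by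
  subst hWm
  exact X8.bsdp_three_rankZero_of_ainvs_of_selmerGroup_ne_bot_of_surj hCT hW hGZK hmod
    1 (-1) 1 (-2091) (-36272)
    (isGloballyMinimal_of_krausCriterion_bounded 1 (-1) 1 (-2091) (-36272)
      (by decide +kernel) (by decide +kernel) (by decide +kernel))
    (by decide) (n₃ := 1) (by decide +kernel) (by decide) surj_x8r0_4229a1_3 hr hq hv hSel

/-- **`BSD(E,3)` for `4592f1`** — X8 ∩ {r_an = 0} ∩ {surj(3)}, `#Ш_an = 9`; Cremona model `[0,0,0,-309643,-61048006]`,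
`N = 4592 = 2⁴·7·41`, good supersingular at `3` with `a₃ = 3`, `ρ̄_{E,3}` onto (`surj_x8r0_4592f1_3`), `#E(ℚ)_tors = 1`,
`∏ c_ℓ = 2`. Kernel-decided: global minimality (the bounded Kraus certificate of `surj_x8r0_4592f1_3`, verbatim), `3 ∤ Δ`, `#Ẽ(𝔽₃) = 1`. Binders: PUBLISHED `hCT`,
`hW`, `hGZK`, `hmod`; per pair `hr`, `hq`/`hv` (`#Ш_an = 9`), `hSel : Sel^(3)(E/ℚ) ≠ ⊥` — EVIDENCE: the landed
two-engine exact `3`-descent row of `4592f1` in `Supersingular/X8DescentRecords.lean` (`checked_x8_rankZero_sha9_desc3_1`;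
`dim_𝔽₃ Sel^(3) = 2` on both engines, same subspace; cert `a013a4bf0762…`; kit j091546). Per pair; OFFER (the
desk books); class X8 and crux 5 unchanged. [cite: Wuthrich2014, Prop. 21 (p. 400)]
[cite: SilvermanAEC2009, Thm. X.4.14 and VII.1 Remark 1.1] [cite: Miller2011LMS, §1 and Def. 1.1]
[cite: Cremona2006, Table 1 (Cremona label 4592f1)] -/
theorem X8.bsdp3_sel9_4592f1 (hCT : exists_casselsTate_pairing (K := ℚ)) (hW : sha_dvd_analyticSha)
    (hGZK : rank_eq_analyticRank_of_analyticRank_le_one) (hmod : hasEntireLFunction_rat)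
    (W : WeierstrassCurve ℚ) (hWm : W = ⟨0, 0, 0, -309643, -61048006⟩) (hr : W.analyticRank = 0)
    {q : ℚ} (hq : shaAn W = (q : ℂ)) (hv : padicValRat 3 q ≤ 2) (hSel : W.selmerGroup (3 : ℤ) ≠ ⊥) :
    BSDp W 3 := by
  subst hWm
  exact X8.bsdp_three_rankZero_of_ainvs_of_selmerGroup_ne_bot_of_surj hCT hW hGZK hmod
    0 0 0 (-309643) (-61048006)
    (isGloballyMinimal_of_krausCriterion₃_bounded 0 0 0 (-309643) (-61048006)
      (by decide +kernel) (by decide +kernel)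
      (by set_option synthInstance.maxSize 2000 in decide +kernel))
    (by decide) (n₃ := 1) (by decide +kernel) (by decide) surj_x8r0_4592f1_3 hr hq hv hSel

/-- **`BSD(E,3)` for `6118f1`** — X8 ∩ {r_an = 0} ∩ {surj(3)}, `#Ш_an = 9`; Cremona model `[1,-1,1,3369,-49157]`,
`N = 6118 = 2·7·19·23`, good supersingular at `3` with `a₃ = 3`, `ρ̄_{E,3}` onto (`surj_x8r0_6118f1_3`), `#E(ℚ)_tors = 1`,
`∏ c_ℓ = 2`. Kernel-decided: global minimality (the bounded Kraus certificate of `surj_x8r0_6118f1_3`, verbatim), `3 ∤ Δ`, `#Ẽ(𝔽₃) = 1`. Binders: PUBLISHED `hCT`,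
`hW`, `hGZK`, `hmod`; per pair `hr`, `hq`/`hv` (`#Ш_an = 9`), `hSel : Sel^(3)(E/ℚ) ≠ ⊥` — EVIDENCE: the landed
two-engine exact `3`-descent row of `6118f1` in `Supersingular/X8DescentRecords.lean` (`checked_x8_rankZero_sha9_desc3_1`;
`dim_𝔽₃ Sel^(3) = 2` on both engines, same subspace; cert `cb45c5802fb3…`; kit j091546). Per pair; OFFER (the
desk books); class X8 and crux 5 unchanged. [cite: Wuthrich2014, Prop. 21 (p. 400)]
[cite: SilvermanAEC2009, Thm. X.4.14 and VII.1 Remark 1.1] [cite: Miller2011LMS, §1 and Def. 1.1]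
[cite: Cremona2006, Table 1 (Cremona label 6118f1)] -/
theorem X8.bsdp3_sel9_6118f1 (hCT : exists_casselsTate_pairing (K := ℚ)) (hW : sha_dvd_analyticSha)
    (hGZK : rank_eq_analyticRank_of_analyticRank_le_one) (hmod : hasEntireLFunction_rat)
    (W : WeierstrassCurve ℚ) (hWm : W = ⟨1, -1, 1, 3369, -49157⟩) (hr : W.analyticRank = 0)
    {q : ℚ} (hq : shaAn W = (q : ℂ)) (hv : padicValRat 3 q ≤ 2) (hSel : W.selmerGroup (3 : ℤ) ≠ ⊥) :
    BSDp W 3 := by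
  subst hWm
  exact X8.bsdp_three_rankZero_of_ainvs_of_selmerGroup_ne_bot_of_surj hCT hW hGZK hmod
    1 (-1) 1 3369 (-49157)
    (isGloballyMinimal_of_krausCriterion_bounded 1 (-1) 1 3369 (-49157)
      (by decide +kernel) (by decide +kernel) (by decide +kernel))
    (by decide) (n₃ := 1) (by decide +kernel) (by decide) surj_x8r0_6118f1_3 hr hq hv hSel

/-- **`BSD(E,3)` for `6419b1`** — X8 ∩ {r_an = 0} ∩ {surj(3)}, `#Ш_an = 9`; Cremona model `[0,0,1,-2401,46219]`,
`N = 6419 = 7²·131`, good supersingular at `3` with `a₃ = 3`, `ρ̄_{E,3}` onto (`surj_x8r0_6419b1_3`), `#E(ℚ)_tors = 1`,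
`∏ c_ℓ = 1`. Kernel-decided: global minimality (the bounded Kraus certificate of `surj_x8r0_6419b1_3`, verbatim), `3 ∤ Δ`, `#Ẽ(𝔽₃) = 1`. Binders: PUBLISHED `hCT`,
`hW`, `hGZK`, `hmod`; per pair `hr`, `hq`/`hv` (`#Ш_an = 9`), `hSel : Sel^(3)(E/ℚ) ≠ ⊥` — EVIDENCE: the landed
two-engine exact `3`-descent row of `6419b1` in `Supersingular/X8DescentRecords.lean` (`checked_x8_rankZero_sha9_desc3_1`;
`dim_𝔽₃ Sel^(3) = 2` on both engines, same subspace; cert `71aab822093d…`; kit j091546). Per pair; OFFER (the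
desk books); class X8 and crux 5 unchanged. [cite: Wuthrich2014, Prop. 21 (p. 400)]
[cite: SilvermanAEC2009, Thm. X.4.14 and VII.1 Remark 1.1] [cite: Miller2011LMS, §1 and Def. 1.1]
[cite: Cremona2006, Table 1 (Cremona label 6419b1)] -/
theorem X8.bsdp3_sel9_6419b1 (hCT : exists_casselsTate_pairing (K := ℚ)) (hW : sha_dvd_analyticSha)
    (hGZK : rank_eq_analyticRank_of_analyticRank_le_one) (hmod : hasEntireLFunction_rat)
    (W : WeierstrassCurve ℚ) (hWm : W = ⟨0, 0, 1, -2401, 46219⟩) (hr : W.analyticRank = 0)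
    {q : ℚ} (hq : shaAn W = (q : ℂ)) (hv : padicValRat 3 q ≤ 2) (hSel : W.selmerGroup (3 : ℤ) ≠ ⊥) :
    BSDp W 3 := by
  subst hWm
  exact X8.bsdp_three_rankZero_of_ainvs_of_selmerGroup_ne_bot_of_surj hCT hW hGZK hmod
    0 0 1 (-2401) 46219
    (isGloballyMinimal_of_krausCriterion_bounded 0 0 1 (-2401) 46219
      (by decide +kernel) (by decide +kernel) (by decide +kernel))
    (by decide) (n₃ := 1) (by decide +kernel) (by decide) surj_x8r0_6419b1_3 hr hq hv hSel

/-- **`BSD(E,3)` for `6970d1`** — X8 ∩ {r_an = 0} ∩ {surj(3)}, `#Ш_an = 9`; Cremona model `[1,-1,0,-47290,-3946444]`,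
`N = 6970 = 2·5·17·41`, good supersingular at `3` with `a₃ = 3`, `ρ̄_{E,3}` onto (`surj_x8r0_6970d1_3`), `#E(ℚ)_tors = 1`,
`∏ c_ℓ = 2`. Kernel-decided: global minimality (the bounded Kraus certificate of `surj_x8r0_6970d1_3`, verbatim), `3 ∤ Δ`, `#Ẽ(𝔽₃) = 1`. Binders: PUBLISHED `hCT`,
`hW`, `hGZK`, `hmod`; per pair `hr`, `hq`/`hv` (`#Ш_an = 9`), `hSel : Sel^(3)(E/ℚ) ≠ ⊥` — EVIDENCE: the landed
two-engine exact `3`-descent row of `6970d1` in `Supersingular/X8DescentRecords.lean` (`checked_x8_rankZero_sha9_desc3_1`;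
`dim_𝔽₃ Sel^(3) = 2` on both engines, same subspace; cert `db77d7fa2da9…`; kit j091546). Per pair; OFFER (the
desk books); class X8 and crux 5 unchanged. [cite: Wuthrich2014, Prop. 21 (p. 400)]
[cite: SilvermanAEC2009, Thm. X.4.14 and VII.1 Remark 1.1] [cite: Miller2011LMS, §1 and Def. 1.1]
[cite: Cremona2006, Table 1 (Cremona label 6970d1)] -/
theorem X8.bsdp3_sel9_6970d1 (hCT : exists_casselsTate_pairing (K := ℚ)) (hW : sha_dvd_analyticSha)
    (hGZK : rank_eq_analyticRank_of_analyticRank_le_one) (hmod : hasEntireLFunction_rat)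
    (W : WeierstrassCurve ℚ) (hWm : W = ⟨1, -1, 0, -47290, -3946444⟩) (hr : W.analyticRank = 0)
    {q : ℚ} (hq : shaAn W = (q : ℂ)) (hv : padicValRat 3 q ≤ 2) (hSel : W.selmerGroup (3 : ℤ) ≠ ⊥) :
    BSDp W 3 := by
  subst hWm
  exact X8.bsdp_three_rankZero_of_ainvs_of_selmerGroup_ne_bot_of_surj hCT hW hGZK hmod
    1 (-1) 0 (-47290) (-3946444)
    (isGloballyMinimal_of_krausCriterion_bounded 1 (-1) 0 (-47290) (-3946444)
      (by decide +kernel) (by decide +kernel) (by decide +kernel))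
    (by decide) (n₃ := 1) (by decide +kernel) (by decide) surj_x8r0_6970d1_3 hr hq hv hSel

/-- **`BSD(E,3)` for `7234b1`** — X8 ∩ {r_an = 0} ∩ {surj(3)}, `#Ш_an = 9`; Cremona model `[1,-1,0,-7591,-798211]`,
`N = 7234 = 2·3617`, good supersingular at `3` with `a₃ = 3`, `ρ̄_{E,3}` onto (`surj_x8r0_7234b1_3`), `#E(ℚ)_tors = 1`,
`∏ c_ℓ = 2`. Kernel-decided: global minimality (the bounded Kraus certificate of `surj_x8r0_7234b1_3`, verbatim), `3 ∤ Δ`, `#Ẽ(𝔽₃) = 1`. Binders: PUBLISHED `hCT`,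
`hW`, `hGZK`, `hmod`; per pair `hr`, `hq`/`hv` (`#Ш_an = 9`), `hSel : Sel^(3)(E/ℚ) ≠ ⊥` — EVIDENCE: the landed
two-engine exact `3`-descent row of `7234b1` in `Supersingular/X8DescentRecords.lean` (`checked_x8_rankZero_sha9_desc3_1`;
`dim_𝔽₃ Sel^(3) = 2` on both engines, same subspace; cert `b9f60c625d56…`; kit j091546). Per pair; OFFER (the
desk books); class X8 and crux 5 unchanged. [cite: Wuthrich2014, Prop. 21 (p. 400)]
[cite: SilvermanAEC2009, Thm. X.4.14 and VII.1 Remark 1.1] [cite: Miller2011LMS, §1 and Def. 1.1]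
[cite: Cremona2006, Table 1 (Cremona label 7234b1)] -/
theorem X8.bsdp3_sel9_7234b1 (hCT : exists_casselsTate_pairing (K := ℚ)) (hW : sha_dvd_analyticSha)
    (hGZK : rank_eq_analyticRank_of_analyticRank_le_one) (hmod : hasEntireLFunction_rat)
    (W : WeierstrassCurve ℚ) (hWm : W = ⟨1, -1, 0, -7591, -798211⟩) (hr : W.analyticRank = 0)
    {q : ℚ} (hq : shaAn W = (q : ℂ)) (hv : padicValRat 3 q ≤ 2) (hSel : W.selmerGroup (3 : ℤ) ≠ ⊥) :
    BSDp W 3 := by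
  subst hWm
  exact X8.bsdp_three_rankZero_of_ainvs_of_selmerGroup_ne_bot_of_surj hCT hW hGZK hmod
    1 (-1) 0 (-7591) (-798211)
    (isGloballyMinimal_of_krausCriterion_bounded 1 (-1) 0 (-7591) (-798211)
      (by decide +kernel) (by decide +kernel) (by decide +kernel))
    (by decide) (n₃ := 1) (by decide +kernel) (by decide) surj_x8r0_7234b1_3 hr hq hv hSel

/-- **`BSD(E,3)` for `7310d1`** — X8 ∩ {r_an = 0} ∩ {surj(3)}, `#Ш_an = 9`; Cremona model `[1,-1,0,106760,24868160]`,
`N = 7310 = 2·5·17·43`, good supersingular at `3` with `a₃ = 3`, `ρ̄_{E,3}` onto (`surj_x8r0_7310d1_3`), `#E(ℚ)_tors = 1`,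
`∏ c_ℓ = 2`. Kernel-decided: global minimality (the bounded Kraus certificate of `surj_x8r0_7310d1_3`, verbatim), `3 ∤ Δ`, `#Ẽ(𝔽₃) = 1`. Binders: PUBLISHED `hCT`,
`hW`, `hGZK`, `hmod`; per pair `hr`, `hq`/`hv` (`#Ш_an = 9`), `hSel : Sel^(3)(E/ℚ) ≠ ⊥` — EVIDENCE: the landed
two-engine exact `3`-descent row of `7310d1` in `Supersingular/X8DescentRecords.lean` (`checked_x8_rankZero_sha9_desc3_1`;
`dim_𝔽₃ Sel^(3) = 2` on both engines, same subspace; cert `b4a013725c0f…`; kit j091546). Per pair; OFFER (the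
desk books); class X8 and crux 5 unchanged. [cite: Wuthrich2014, Prop. 21 (p. 400)]
[cite: SilvermanAEC2009, Thm. X.4.14 and VII.1 Remark 1.1] [cite: Miller2011LMS, §1 and Def. 1.1]
[cite: Cremona2006, Table 1 (Cremona label 7310d1)] -/
theorem X8.bsdp3_sel9_7310d1 (hCT : exists_casselsTate_pairing (K := ℚ)) (hW : sha_dvd_analyticSha)
    (hGZK : rank_eq_analyticRank_of_analyticRank_le_one) (hmod : hasEntireLFunction_rat)
    (W : WeierstrassCurve ℚ) (hWm : W = ⟨1, -1, 0, 106760, 24868160⟩) (hr : W.analyticRank = 0)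
    {q : ℚ} (hq : shaAn W = (q : ℂ)) (hv : padicValRat 3 q ≤ 2) (hSel : W.selmerGroup (3 : ℤ) ≠ ⊥) :
    BSDp W 3 := by
  subst hWm
  exact X8.bsdp_three_rankZero_of_ainvs_of_selmerGroup_ne_bot_of_surj hCT hW hGZK hmod
    1 (-1) 0 106760 24868160
    (isGloballyMinimal_of_krausCriterion_bounded 1 (-1) 0 106760 24868160
      (by decide +kernel) (by decide +kernel) (by decide +kernel))
    (by decide) (n₃ := 1) (by decide +kernel) (by decide) surj_x8r0_7310d1_3 hr hq hv hSel

/-- **`BSD(E,3)` for `7744n1`** — X8 ∩ {r_an = 0} ∩ {surj(3)}, `#Ш_an = 9`; Cremona model `[0,0,0,-1936,-42592]`,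
`N = 7744 = 2⁶·11²`, good supersingular at `3` with `a₃ = 3`, `ρ̄_{E,3}` onto (`surj_x8r0_7744n1_3`), `#E(ℚ)_tors = 1`,
`∏ c_ℓ = 2`. Kernel-decided: global minimality (the bounded Kraus certificate of `surj_x8r0_7744n1_3`, verbatim), `3 ∤ Δ`, `#Ẽ(𝔽₃) = 1`. Binders: PUBLISHED `hCT`,
`hW`, `hGZK`, `hmod`; per pair `hr`, `hq`/`hv` (`#Ш_an = 9`), `hSel : Sel^(3)(E/ℚ) ≠ ⊥` — EVIDENCE: the landed
two-engine exact `3`-descent row of `7744n1` in `Supersingular/X8DescentRecords.lean` (`checked_x8_rankZero_sha9_desc3_1`;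
`dim_𝔽₃ Sel^(3) = 2` on both engines, same subspace; cert `605c87cd98d1…`; kit j091546). Per pair; OFFER (the
desk books); class X8 and crux 5 unchanged. [cite: Wuthrich2014, Prop. 21 (p. 400)]
[cite: SilvermanAEC2009, Thm. X.4.14 and VII.1 Remark 1.1] [cite: Miller2011LMS, §1 and Def. 1.1]
[cite: Cremona2006, Table 1 (Cremona label 7744n1)] -/
theorem X8.bsdp3_sel9_7744n1 (hCT : exists_casselsTate_pairing (K := ℚ)) (hW : sha_dvd_analyticSha)
    (hGZK : rank_eq_analyticRank_of_analyticRank_le_one) (hmod : hasEntireLFunction_rat)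
    (W : WeierstrassCurve ℚ) (hWm : W = ⟨0, 0, 0, -1936, -42592⟩) (hr : W.analyticRank = 0)
    {q : ℚ} (hq : shaAn W = (q : ℂ)) (hv : padicValRat 3 q ≤ 2) (hSel : W.selmerGroup (3 : ℤ) ≠ ⊥) :
    BSDp W 3 := by
  subst hWm
  exact X8.bsdp_three_rankZero_of_ainvs_of_selmerGroup_ne_bot_of_surj hCT hW hGZK hmod
    0 0 0 (-1936) (-42592)
    (isGloballyMinimal_of_krausCriterion₃_bounded 0 0 0 (-1936) (-42592)
      (by decide +kernel) (by decide +kernel)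
      (by set_option synthInstance.maxSize 2000 in decide +kernel))
    (by decide) (n₃ := 1) (by decide +kernel) (by decide) surj_x8r0_7744n1_3 hr hq hv hSel

/-- **`BSD(E,3)` for `8272b1`** — X8 ∩ {r_an = 0} ∩ {surj(3)}, `#Ш_an = 9`; Cremona model `[0,0,0,-6868,-219556]`,
`N = 8272 = 2⁴·11·47`, good supersingular at `3` with `a₃ = 3`, `ρ̄_{E,3}` onto (`surj_x8r0_8272b1_3`), `#E(ℚ)_tors = 1`,
`∏ c_ℓ = 2`. Kernel-decided: global minimality (the bounded Kraus certificate of `surj_x8r0_8272b1_3`, verbatim), `3 ∤ Δ`, `#Ẽ(𝔽₃) = 1`. Binders: PUBLISHED `hCT`,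
`hW`, `hGZK`, `hmod`; per pair `hr`, `hq`/`hv` (`#Ш_an = 9`), `hSel : Sel^(3)(E/ℚ) ≠ ⊥` — EVIDENCE: the landed
two-engine exact `3`-descent row of `8272b1` in `Supersingular/X8DescentRecords.lean` (`checked_x8_rankZero_sha9_desc3_1`;
`dim_𝔽₃ Sel^(3) = 2` on both engines, same subspace; cert `4f561e5b1c34…`; kit j091546). Per pair; OFFER (the
desk books); class X8 and crux 5 unchanged. [cite: Wuthrich2014, Prop. 21 (p. 400)]
[cite: SilvermanAEC2009, Thm. X.4.14 and VII.1 Remark 1.1] [cite: Miller2011LMS, §1 and Def. 1.1]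
[cite: Cremona2006, Table 1 (Cremona label 8272b1)] -/
theorem X8.bsdp3_sel9_8272b1 (hCT : exists_casselsTate_pairing (K := ℚ)) (hW : sha_dvd_analyticSha)
    (hGZK : rank_eq_analyticRank_of_analyticRank_le_one) (hmod : hasEntireLFunction_rat)
    (W : WeierstrassCurve ℚ) (hWm : W = ⟨0, 0, 0, -6868, -219556⟩) (hr : W.analyticRank = 0)
    {q : ℚ} (hq : shaAn W = (q : ℂ)) (hv : padicValRat 3 q ≤ 2) (hSel : W.selmerGroup (3 : ℤ) ≠ ⊥) :
    BSDp W 3 := by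
  subst hWm
  exact X8.bsdp_three_rankZero_of_ainvs_of_selmerGroup_ne_bot_of_surj hCT hW hGZK hmod
    0 0 0 (-6868) (-219556)
    (isGloballyMinimal_of_krausCriterion_bounded 0 0 0 (-6868) (-219556)
      (by decide +kernel) (by decide +kernel) (by decide +kernel))
    (by decide) (n₃ := 1) (by decide +kernel) (by decide) surj_x8r0_8272b1_3 hr hq hv hSel

/-- **`BSD(E,3)` for `8510c1`** — X8 ∩ {r_an = 0} ∩ {surj(3)}, `#Ш_an = 9`; Cremona model `[1,-1,0,-143530,21103220]`,
`N = 8510 = 2·5·23·37`, good supersingular at `3` with `a₃ = 3`, `ρ̄_{E,3}` onto (`surj_x8r0_8510c1_3`), `#E(ℚ)_tors = 1`,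
`∏ c_ℓ = 1`. Kernel-decided: global minimality (the bounded Kraus certificate of `surj_x8r0_8510c1_3`, verbatim), `3 ∤ Δ`, `#Ẽ(𝔽₃) = 1`. Binders: PUBLISHED `hCT`,
`hW`, `hGZK`, `hmod`; per pair `hr`, `hq`/`hv` (`#Ш_an = 9`), `hSel : Sel^(3)(E/ℚ) ≠ ⊥` — EVIDENCE: the landed
two-engine exact `3`-descent row of `8510c1` in `Supersingular/X8DescentRecords.lean` (`checked_x8_rankZero_sha9_desc3_1`;
`dim_𝔽₃ Sel^(3) = 2` on both engines, same subspace; cert `1b1de4f8ee7c…`; kit j091546). Per pair; OFFER (the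
desk books); class X8 and crux 5 unchanged. [cite: Wuthrich2014, Prop. 21 (p. 400)]
[cite: SilvermanAEC2009, Thm. X.4.14 and VII.1 Remark 1.1] [cite: Miller2011LMS, §1 and Def. 1.1]
[cite: Cremona2006, Table 1 (Cremona label 8510c1)] -/
theorem X8.bsdp3_sel9_8510c1 (hCT : exists_casselsTate_pairing (K := ℚ)) (hW : sha_dvd_analyticSha)
    (hGZK : rank_eq_analyticRank_of_analyticRank_le_one) (hmod : hasEntireLFunction_rat)
    (W : WeierstrassCurve ℚ) (hWm : W = ⟨1, -1, 0, -143530, 21103220⟩) (hr : W.analyticRank = 0)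
    {q : ℚ} (hq : shaAn W = (q : ℂ)) (hv : padicValRat 3 q ≤ 2) (hSel : W.selmerGroup (3 : ℤ) ≠ ⊥) :
    BSDp W 3 := by
  subst hWm
  exact X8.bsdp_three_rankZero_of_ainvs_of_selmerGroup_ne_bot_of_surj hCT hW hGZK hmod
    1 (-1) 0 (-143530) 21103220
    (isGloballyMinimal_of_krausCriterion_bounded 1 (-1) 0 (-143530) 21103220
      (by decide +kernel) (by decide +kernel) (by decide +kernel))
    (by decide) (n₃ := 1) (by decide +kernel) (by decide) surj_x8r0_8510c1_3 hr hq hv hSel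

/-- **`BSD(E,3)` for `8747d1`** — X8 ∩ {r_an = 0} ∩ {surj(3)}, `#Ш_an = 9`; Cremona model `[0,0,1,-1609,-24842]`,
`N = 8747 = 8747`, good supersingular at `3` with `a₃ = 3`, `ρ̄_{E,3}` onto (`surj_x8r0_8747d1_3`), `#E(ℚ)_tors = 1`,
`∏ c_ℓ = 1`. Kernel-decided: global minimality (the bounded Kraus certificate of `surj_x8r0_8747d1_3`, verbatim), `3 ∤ Δ`, `#Ẽ(𝔽₃) = 1`. Binders: PUBLISHED `hCT`,
`hW`, `hGZK`, `hmod`; per pair `hr`, `hq`/`hv` (`#Ш_an = 9`), `hSel : Sel^(3)(E/ℚ) ≠ ⊥` — EVIDENCE: the landed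
two-engine exact `3`-descent row of `8747d1` in `Supersingular/X8DescentRecords.lean` (`checked_x8_rankZero_sha9_desc3_1`;
`dim_𝔽₃ Sel^(3) = 2` on both engines, same subspace; cert `ff9138b6534d…`; kit j091546). Per pair; OFFER (the
desk books); class X8 and crux 5 unchanged. [cite: Wuthrich2014, Prop. 21 (p. 400)]
[cite: SilvermanAEC2009, Thm. X.4.14 and VII.1 Remark 1.1] [cite: Miller2011LMS, §1 and Def. 1.1]
[cite: Cremona2006, Table 1 (Cremona label 8747d1)] -/
theorem X8.bsdp3_sel9_8747d1 (hCT : exists_casselsTate_pairing (K := ℚ)) (hW : sha_dvd_analyticSha)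
    (hGZK : rank_eq_analyticRank_of_analyticRank_le_one) (hmod : hasEntireLFunction_rat)
    (W : WeierstrassCurve ℚ) (hWm : W = ⟨0, 0, 1, -1609, -24842⟩) (hr : W.analyticRank = 0)
    {q : ℚ} (hq : shaAn W = (q : ℂ)) (hv : padicValRat 3 q ≤ 2) (hSel : W.selmerGroup (3 : ℤ) ≠ ⊥) :
    BSDp W 3 := by
  subst hWm
  exact X8.bsdp_three_rankZero_of_ainvs_of_selmerGroup_ne_bot_of_surj hCT hW hGZK hmod
    0 0 1 (-1609) (-24842)
    (isGloballyMinimal_of_krausCriterion_bounded 0 0 1 (-1609) (-24842)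
      (by decide +kernel) (by decide +kernel) (by decide +kernel))
    (by decide) (n₃ := 1) (by decide +kernel) (by decide) surj_x8r0_8747d1_3 hr hq hv hSel

/-- **`BSD(E,3)` for `9200w1`** — X8 ∩ {r_an = 0} ∩ {surj(3)}, `#Ш_an = 9`; Cremona model `[0,0,0,-1825,-306625]`,
`N = 9200 = 2⁴·5²·23`, good supersingular at `3` with `a₃ = 3`, `ρ̄_{E,3}` onto (`surj_x8r0_9200w1_3`), `#E(ℚ)_tors = 1`,
`∏ c_ℓ = 2`. Kernel-decided: global minimality (the bounded Kraus certificate of `surj_x8r0_9200w1_3`, verbatim), `3 ∤ Δ`, `#Ẽ(𝔽₃) = 1`. Binders: PUBLISHED `hCT`,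
`hW`, `hGZK`, `hmod`; per pair `hr`, `hq`/`hv` (`#Ш_an = 9`), `hSel : Sel^(3)(E/ℚ) ≠ ⊥` — EVIDENCE: the landed
two-engine exact `3`-descent row of `9200w1` in `Supersingular/X8DescentRecords.lean` (`checked_x8_rankZero_sha9_desc3_2`;
`dim_𝔽₃ Sel^(3) = 2` on both engines, same subspace; cert `1d09cfd4d8e4…`; kit j091546). Per pair; OFFER (the
desk books); class X8 and crux 5 unchanged. [cite: Wuthrich2014, Prop. 21 (p. 400)]
[cite: SilvermanAEC2009, Thm. X.4.14 and VII.1 Remark 1.1] [cite: Miller2011LMS, §1 and Def. 1.1]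
[cite: Cremona2006, Table 1 (Cremona label 9200w1)] -/
theorem X8.bsdp3_sel9_9200w1 (hCT : exists_casselsTate_pairing (K := ℚ)) (hW : sha_dvd_analyticSha)
    (hGZK : rank_eq_analyticRank_of_analyticRank_le_one) (hmod : hasEntireLFunction_rat)
    (W : WeierstrassCurve ℚ) (hWm : W = ⟨0, 0, 0, -1825, -306625⟩) (hr : W.analyticRank = 0)
    {q : ℚ} (hq : shaAn W = (q : ℂ)) (hv : padicValRat 3 q ≤ 2) (hSel : W.selmerGroup (3 : ℤ) ≠ ⊥) :
    BSDp W 3 := by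
  subst hWm
  exact X8.bsdp_three_rankZero_of_ainvs_of_selmerGroup_ne_bot_of_surj hCT hW hGZK hmod
    0 0 0 (-1825) (-306625)
    (isGloballyMinimal_of_krausCriterion_bounded 0 0 0 (-1825) (-306625)
      (by decide +kernel) (by decide +kernel) (by decide +kernel))
    (by decide) (n₃ := 1) (by decide +kernel) (by decide) surj_x8r0_9200w1_3 hr hq hv hSel

end Summit.BirchSwinnertonDyer.BirchSwinnertonDyer.Theorems

end
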